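import Summits.AtomisticToContinuum.HydrodynamicLimit.Theorems.RelayRaceLocalityNearConstantShortTimeHLAssemblyDefs
import Summits.AtomisticToContinuum.HydrodynamicLimit.Theorems.RelayRaceLocalityNearConstantShortTimeHLCommutators
import Literature.MathematicalPhysics.KineticTheory.HardSphereEulerProofs
import HarnessLib

/-!
# Crux `NearConstantShortTimeHL` (stmt-AtomisticToContinuum-12502), line `small-tilt-domination` — objects of the
conditional Gaussian chessboard estimate (`stub_velocityLD`) and the pointwise domination of `fluctuationE`

Given the positions `x` of `m` particles and velocities `v`, the ball averages of the configuration `zipConfig (x, v)`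
at a centre `y` split into a POSITION part (the conditional Gaussian means given the positions) and a VELOCITY
fluctuation: `m̃ = mb + μ`, `ẽ = eb + ζ` with `μ = velDev`, `ζ = enDev`. This file defines these objects and proves the
pointwise (in `y`) domination of the integrand of the energy-weighted mesoscale deviation `fluctuationE` by
(position term) + (capped velocity term, `chessIntegrand`) + (linear kinetic term), the first step of the velocity
estimate. No probability here.

References: H.-T. Yau, Lett. Math. Phys. 22 (1991) §2 (the relative-entropy method's local large deviations).
-/

noncomputable section

namespace Summit.AtomisticToContinuum.HydrodynamicLimit.Theorems.NearConstantShortTimeHL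

open scoped BigOperators ENNReal
open MeasureTheory Set Filter
open Literature.MathematicalPhysics.KineticTheory Literature.Analysis.FluidPDE Literature.Analysis.FunctionSpaces

/-! ## Objects -/

/-- The ball-averaged density of the positions `x` at the centre `y`: `ρ̃ₓ(y) = m⁻¹ Σᵢ ballKernel ℓ y xᵢ`
(`= empiricalDensityField (zipConfig (x, v)) (ballKernel ℓ y)` for any velocities `v`). [folklore] -/
def ballDens {m : ℕ} (ℓ : ℝ) (x : Fin m → T3) (y : T3) : ℝ :=
  (m : ℝ)⁻¹ * ∑ i, ballKernel ℓ y (x i)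

/-- The POSITION part of the quadratic mesoscale deviation at `y` (the integrand of `smoothedDeviation` without its
weight and cap): `(ρ̃ − ρ₁)² + ‖mb − ρ₁u₁‖² + (eb − E(ρ₁,u₁,θ₁))²` with the conditional means
`mb(y) = m⁻¹ Σᵢ K(y,xᵢ) u₁(xᵢ)`, `eb(y) = m⁻¹ Σᵢ K(y,xᵢ)(‖u₁(xᵢ)‖²/2 + 3θ₁(xᵢ)/2)`. [cite: Yau1991, §2] -/
def posDev {m : ℕ} (ℓ : ℝ) (ρ₁ θ₁ : T3 → ℝ) (u₁ : T3 → V3) (x : Fin m → T3) (y : T3) : ℝ :=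
  ((m : ℝ)⁻¹ * ∑ i, ballKernel ℓ y (x i) - ρ₁ y) ^ 2 +
    ‖(m : ℝ)⁻¹ • ∑ i, ballKernel ℓ y (x i) • u₁ (x i) - ρ₁ y • u₁ y‖ ^ 2 +
    ((m : ℝ)⁻¹ * ∑ i, ballKernel ℓ y (x i) * (‖u₁ (x i)‖ ^ 2 / 2 + 3 / 2 * θ₁ (x i)) -
      totalEnergyDensity (ρ₁ y) (u₁ y) (θ₁ y)) ^ 2

/-- The VELOCITY fluctuation of the ball-averaged momentum at `y`: `μ(y) = m⁻¹ Σᵢ K(y,xᵢ)(vᵢ − u₁(xᵢ))`.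
[cite: Yau1991, §2] -/
def velDev {m : ℕ} (ℓ : ℝ) (u₁ : T3 → V3) (x : Fin m → T3) (v : Fin m → V3) (y : T3) : V3 :=
  (m : ℝ)⁻¹ • ∑ i, ballKernel ℓ y (x i) • (v i - u₁ (x i))

/-- The VELOCITY fluctuation of the ball-averaged kinetic energy at `y`:
`ζ(y) = m⁻¹ Σᵢ K(y,xᵢ)(‖vᵢ‖²/2 − ‖u₁(xᵢ)‖²/2 − 3θ₁(xᵢ)/2)`. [cite: Yau1991, §2] -/
def enDev {m : ℕ} (ℓ : ℝ) (θ₁ : T3 → ℝ) (u₁ : T3 → V3) (x : Fin m → T3) (v : Fin m → V3) (y : T3) : ℝ :=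
  (m : ℝ)⁻¹ * ∑ i, ballKernel ℓ y (x i) * (‖v i‖ ^ 2 / 2 - ‖u₁ (x i)‖ ^ 2 / 2 - 3 / 2 * θ₁ (x i))

/-- The CHESSBOARD integrand at `y` (the capped velocity terms of the domination of `fluctuationE`, box size `M`):
`(2 + 2(1 + (1 + c_M)ρ̃)) · min 1 (‖μ‖² + ζ²) + 2 · ζ 𝟙{ζ > 1}`, `c_M = M²/2 + 3M/2`. [cite: Yau1991, §2] -/
def chessIntegrand {m : ℕ} (M ℓ : ℝ) (θ₁ : T3 → ℝ) (u₁ : T3 → V3) (x : Fin m → T3) (v : Fin m → V3) (y : T3) : ℝ :=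
  (2 + 2 * (1 + (1 + (M ^ 2 / 2 + 3 / 2 * M)) * ballDens ℓ x y)) *
      min 1 (‖velDev ℓ u₁ x v y‖ ^ 2 + enDev ℓ θ₁ u₁ x v y ^ 2) +
    2 * (if 1 < enDev ℓ θ₁ u₁ x v y then enDev ℓ θ₁ u₁ x v y else 0)

/-- The weight of particle `i` in the LINEAR kinetic term of the domination of `fluctuationE`:
`wᵢ = ∫ K(y, xᵢ) min 1 (posDev y) dy ∈ [0, 1]`, with `Σᵢ wᵢ ≤ m · smoothedDeviation`. [cite: Yau1991, §2] -/
def linWeight {m : ℕ} (ℓ : ℝ) (ρ₁ θ₁ : T3 → ℝ) (u₁ : T3 → V3) (x : Fin m → T3) (i : Fin m) : ℝ :=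
  ∫ y, ballKernel ℓ y (x i) * min 1 (posDev ℓ ρ₁ θ₁ u₁ x y)

/-! ## The ball averages of `zipConfig (x, v)` -/

/-- The ball-averaged density of `zipConfig (x, v)` is `ballDens`. [folklore] -/
theorem empiricalDensityField_zipConfig_ballKernel {m : ℕ} (ℓ : ℝ) (x : Fin m → T3) (v : Fin m → V3) (y : T3) :
    empiricalDensityField (zipConfig (x, v)) (ballKernel ℓ y) = ballDens ℓ x y := by
  rw [empiricalDensityField_eq_sum]
  rfl

/-- The ball-averaged momentum of `zipConfig (x, v)` is `mb + μ`. [folklore] -/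
theorem empiricalMomentumField_zipConfig_ballKernel {m : ℕ} (ℓ : ℝ) (u₁ : T3 → V3) (x : Fin m → T3)
    (v : Fin m → V3) (y : T3) :
    empiricalMomentumField (zipConfig (x, v)) (ballKernel ℓ y) =
      (m : ℝ)⁻¹ • ∑ i, ballKernel ℓ y (x i) • u₁ (x i) + velDev ℓ u₁ x v y := by
  rw [empiricalMomentumField_eq_sum, velDev, ← smul_add, ← Finset.sum_add_distrib]
  congr 1
  refine Finset.sum_congr rfl fun i _ => ?_
  rw [← smul_add, zipConfig_apply, add_sub_cancel]

/-- The ball-averaged kinetic energy of `zipConfig (x, v)` is `eb + ζ`. [folklore] -/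
theorem empiricalEnergyField_zipConfig_ballKernel {m : ℕ} (ℓ : ℝ) (θ₁ : T3 → ℝ) (u₁ : T3 → V3)
    (x : Fin m → T3) (v : Fin m → V3) (y : T3) :
    empiricalEnergyField (zipConfig (x, v)) (ballKernel ℓ y) =
      (m : ℝ)⁻¹ * ∑ i, ballKernel ℓ y (x i) * (‖u₁ (x i)‖ ^ 2 / 2 + 3 / 2 * θ₁ (x i)) + enDev ℓ θ₁ u₁ x v y := by
  rw [empiricalEnergyField_eq_sum, enDev, ← mul_add, ← Finset.sum_add_distrib]
  congr 1
  refine Finset.sum_congr rfl fun i _ => ?_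
  rw [← mul_add, zipConfig_apply]
  ring

/-! ## Elementary inequalities -/

/-- `min 1 (a + b) ≤ min 1 a + min 1 b` for `0 ≤ a, b`. [folklore] -/
theorem min_one_add_le {a b : ℝ} (ha : 0 ≤ a) (hb : 0 ≤ b) : min 1 (a + b) ≤ min 1 a + min 1 b := by
  rcases le_total 1 a with h1 | h1
  · rw [min_eq_left h1]
    exact (min_le_left _ _).trans (by linarith [le_min zero_le_one hb])
  · rw [min_eq_right h1]
    rcases le_total 1 b with h2 | h2
    · rw [min_eq_left h2]; exact (min_le_left _ _).trans (by linarith)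
    · rw [min_eq_right h2]; exact min_le_right _ _

/-- `min 1 (2a) ≤ 2 min 1 a` for `0 ≤ a`. [folklore] -/
theorem min_one_two_mul_le (a : ℝ) : min 1 (2 * a) ≤ 2 * min 1 a := by
  rcases le_total 1 a with h1 | h1
  · rw [min_eq_left h1]; exact (min_le_left _ _).trans (by linarith)
  · rw [min_eq_right h1]; exact min_le_right _ _

/-! ## The pointwise domination, abstract form -/

/-- **Core pointwise inequality.** For a nonnegative density `ρ`, a position energy mean `0 ≤ eb ≤ c ρ` (`0 ≤ c`), an
energy fluctuation `ζ` with `0 ≤ eb + ζ` and any upper bound `Z ≥ max 0 ζ`: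
`(1 + ρ + (eb + ζ)) min 1 ((ρ−ρ₁)² + ‖mb + μ − t‖² + (eb + ζ − E₁)²) ≤ 2(1+c)(1+ρ) min 1 D_p
+ (2 + 2(1 + (1+c)ρ)) min 1 (‖μ‖² + ζ²) + 2 ζ𝟙{ζ>1} + 2 Z min 1 D_p`, `D_p = (ρ−ρ₁)² + ‖mb − t‖² + (eb − E₁)²`
(`D ≤ 2D_p + 2D_v`, `min 1` subadditive, weight `≤ 1 + (1+c)ρ + ζ₊`, and `ζ₊ min 1 D_v ≤ min 1 D_v + ζ𝟙{ζ>1}`).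
[cite: Yau1991, §2] -/
theorem weight_mul_min_one_dev_le : ∀ {ρ ρ₁ eb ζ E₁ c Z : ℝ} {mb μ t : V3}, 0 ≤ ρ → eb ≤ c * ρ → 0 ≤ c → 0 ≤ eb + ζ → max 0 ζ ≤ Z → (1 + ρ + (eb + ζ)) * min 1 ((ρ - ρ₁) ^ 2 + ‖mb + μ - t‖ ^ 2 + (eb + ζ - E₁) ^ 2) ≤ 2 * (1 + c) * ((1 + ρ) * min 1 ((ρ - ρ₁) ^ 2 + ‖mb - t‖ ^ 2 + (eb - E₁) ^ 2)) + ((2 + 2 * (1 + (1 + c) * ρ)) * min 1 (‖μ‖ ^ 2 + ζ ^ 2) + 2 * (if 1 < ζ then ζ else 0)) + 2 * (Z * min 1 ((ρ - ρ₁) ^ 2 + ‖mb - t‖ ^ 2 + (eb - E₁) ^ 2)) := by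
  intro ρ ρ₁ eb ζ E₁ c Z mb μ t hρ heb hc hez hZ
  set Dp : ℝ := (ρ - ρ₁) ^ 2 + ‖mb - t‖ ^ 2 + (eb - E₁) ^ 2 with hDp
  set Dv : ℝ := ‖μ‖ ^ 2 + ζ ^ 2 with hDv
  have hDp0 : 0 ≤ Dp := by positivity
  have hDv0 : 0 ≤ Dv := by positivity
  have hmp : 0 ≤ min 1 Dp := le_min zero_le_one hDp0
  have hmv : 0 ≤ min 1 Dv := le_min zero_le_one hDv0
  have hmp1 : min 1 Dp ≤ 1 := min_le_left _ _
  have hmv1 : min 1 Dv ≤ 1 := min_le_left _ _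
  -- `D ≤ 2 D_p + 2 D_v`
  have hD : (ρ - ρ₁) ^ 2 + ‖mb + μ - t‖ ^ 2 + (eb + ζ - E₁) ^ 2 ≤ 2 * Dp + 2 * Dv := by
    have h1 : ‖mb + μ - t‖ ^ 2 ≤ 2 * ‖mb - t‖ ^ 2 + 2 * ‖μ‖ ^ 2 := by
      have hn : ‖mb + μ - t‖ ≤ ‖mb - t‖ + ‖μ‖ := by
        rw [show mb + μ - t = (mb - t) + μ by abel]; exact norm_add_le _ _
      nlinarith [norm_nonneg (mb + μ - t), norm_nonneg (mb - t), norm_nonneg μ, sq_nonneg (‖mb - t‖ - ‖μ‖)]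
    have h2 : (eb + ζ - E₁) ^ 2 ≤ 2 * (eb - E₁) ^ 2 + 2 * ζ ^ 2 := by
      nlinarith [sq_nonneg (eb - E₁ - ζ)]
    nlinarith [sq_nonneg (ρ - ρ₁)]
  -- `min 1 D ≤ 2 min 1 D_p + 2 min 1 D_v`
  have hminD : min 1 ((ρ - ρ₁) ^ 2 + ‖mb + μ - t‖ ^ 2 + (eb + ζ - E₁) ^ 2) ≤ 2 * min 1 Dp + 2 * min 1 Dv := by
    calc min 1 ((ρ - ρ₁) ^ 2 + ‖mb + μ - t‖ ^ 2 + (eb + ζ - E₁) ^ 2)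
        ≤ min 1 (2 * Dp + 2 * Dv) := min_le_min_left _ hD
      _ ≤ min 1 (2 * Dp) + min 1 (2 * Dv) := min_one_add_le (by positivity) (by positivity)
      _ ≤ 2 * min 1 Dp + 2 * min 1 Dv := add_le_add (min_one_two_mul_le Dp) (min_one_two_mul_le Dv)
  -- the weight
  have hW0 : 0 ≤ 1 + ρ + (eb + ζ) := by linarith
  have hW : 1 + ρ + (eb + ζ) ≤ (1 + (1 + c) * ρ) + max 0 ζ := by
    have : ζ ≤ max 0 ζ := le_max_right _ _
    nlinarith
  have hWp0 : 0 ≤ 1 + (1 + c) * ρ := by positivity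
  have hζ0 : 0 ≤ max 0 ζ := le_max_left _ _
  -- `ζ₊ min 1 D_v ≤ min 1 D_v + ζ 𝟙{ζ > 1}`
  have htail : max 0 ζ * min 1 Dv ≤ min 1 Dv + (if 1 < ζ then ζ else 0) := by
    split_ifs with h1
    · rw [max_eq_right (by linarith : (0 : ℝ) ≤ ζ)]
      nlinarith
    · have : max 0 ζ ≤ 1 := max_le zero_le_one (not_lt.mp h1)
      nlinarith
  calc (1 + ρ + (eb + ζ)) * min 1 ((ρ - ρ₁) ^ 2 + ‖mb + μ - t‖ ^ 2 + (eb + ζ - E₁) ^ 2)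
      ≤ ((1 + (1 + c) * ρ) + max 0 ζ) * (2 * min 1 Dp + 2 * min 1 Dv) :=
        mul_le_mul hW hminD (le_min zero_le_one (by positivity)) (hWp0.trans (le_add_of_nonneg_right hζ0))
    _ = 2 * ((1 + (1 + c) * ρ) * min 1 Dp) + 2 * ((1 + (1 + c) * ρ) * min 1 Dv) +
          2 * (max 0 ζ * min 1 Dp) + 2 * (max 0 ζ * min 1 Dv) := by ring
    _ ≤ 2 * ((1 + c) * ((1 + ρ) * min 1 Dp)) + 2 * ((1 + (1 + c) * ρ) * min 1 Dv) +
          2 * (Z * min 1 Dp) + 2 * (min 1 Dv + (if 1 < ζ then ζ else 0)) := by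
        have h1 : (1 + (1 + c) * ρ) * min 1 Dp ≤ (1 + c) * ((1 + ρ) * min 1 Dp) := by
          have h1' : 1 + (1 + c) * ρ ≤ (1 + c) * (1 + ρ) := by nlinarith
          calc (1 + (1 + c) * ρ) * min 1 Dp ≤ (1 + c) * (1 + ρ) * min 1 Dp :=
                mul_le_mul_of_nonneg_right h1' hmp
            _ = (1 + c) * ((1 + ρ) * min 1 Dp) := by ring
        have h3 : max 0 ζ * min 1 Dp ≤ Z * min 1 Dp := mul_le_mul_of_nonneg_right hZ hmp
        linarith
    _ = 2 * (1 + c) * ((1 + ρ) * min 1 Dp) +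
          ((2 + 2 * (1 + (1 + c) * ρ)) * min 1 Dv + 2 * (if 1 < ζ then ζ else 0)) + 2 * (Z * min 1 Dp) := by
        ring

end Summit.AtomisticToContinuum.HydrodynamicLimit.Theorems.NearConstantShortTimeHL

end
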